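import Summits.QuantumAdvantage.QuantumAdvantage.Theorems.SosSandwichTransferPBDescentBound
import HarnessLib

/-!
# Crux `TransferPB` (stmt-QuantumAdvantage-15238, route SosSandwich), line `birth` — the descent may over-estimate the width

Implementation relief for the machine half (M_desc) of stub `stub_pbOracleSimulation`
(`Theorems/SosSandwichTransferPBDescent.lean`): the reference descent explores the levels `j < W` with
`W = oracleWidth F x = n + ancillas(n)` exactly. A transcript machine need not compute `W` exactly: under an
answer function CONSISTENT with the node-test promise problem, a BLOCK instance of a string at least as long as
the width has block magnitude `0 ≤ w/2` (no relevant string extends it), so it is answered `false`, the live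
levels `≥ W` are empty, and the descent run with ANY upper bound `W' ≥ W` returns the same candidates and the
same pick:

* `blockMag_eq_zero_of_le`, `answer_block_false_of_le` — long blocks are empty, hence answered `false`;
* `liveLevel_eq_nil_of_le` — no live string of length `≥ W`;
* **`descentCands_eq_of_le`**, **`descentPick_eq_of_le`** — candidates and pick are unchanged for `W' ≥ W`.

All proved. Source: C. H. Bennett, E. Bernstein, G. Brassard, U. Vazirani, SIAM J. Comput. 26 (1997), Cor. 3.4
(the relevant strings are the short ones); S. Aaronson, A. Ambainis, Theory Comput. 10 (2014), proof of Thm. 23.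
-/

-- D-0017: single-conjunct summit ⇒ the duplicate `QuantumAdvantage.QuantumAdvantage` is mandated.
set_option linter.dupNamespace false

noncomputable section

namespace Summit.QuantumAdvantage.QuantumAdvantage.Cruxes.TransferPB.Birth

open Finset Literature.Computability.Cryptography Literature.Computability.Complexity
  Literature.Computability.QuantumComplexity Literature.Computability.QuantumComplexity.ClassicalSimulation

namespace SimTreePB

variable {F : QCircuitFamily cliffordT} {x : List Bool} {r : Polynomial ℕ} {c k : ℕ} {g : List Bool → Bool}

/-- A block at least as long as the width contains no relevant string: its magnitude is `0`. [folklore] -/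
theorem blockMag_eq_zero_of_le (ρ : List (Fin (numOracleBits F x) × Bool)) {u : List Bool}
    (hu : oracleWidth F x ≤ u.length) : blockMag F x ρ u = 0 := by
  classical
  unfold blockMag
  refine Finset.sum_eq_zero fun s hs => ?_
  exfalso
  have hpre := (mem_filter.1 hs).2
  have hlen := hpre.length_le
  have hlt := length_bitString_lt s
  omega

/-- … so a consistent answer function answers it `false`. [folklore] -/
theorem answer_block_false_of_le (hgn : ∀ v ∈ (nodeProblem F r c k).no, g v = false)
    (ρ : List (Fin (numOracleBits F x) × Bool)) {u : List Bool} (hu : oracleWidth F x ≤ u.length) :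
    g (encBlock F x ρ u) = false :=
  answer_block_false' hgn (by rw [blockMag_eq_zero_of_le ρ hu]; exact (half_pos (pbThreshold_pos F x r c k)).le)

/-- **No live string is as long as the width** (under consistency). [cite: BennettBernsteinBrassardVazirani1997, Cor. 3.4] -/
theorem liveLevel_eq_nil_of_le (hgn : ∀ v ∈ (nodeProblem F r c k).no, g v = false)
    (ρ : List (Fin (numOracleBits F x) × Bool)) {j : ℕ} (hj : oracleWidth F x ≤ j) :
    liveLevel (fun u => g (encBlock F x ρ u)) j = [] := by
  rw [List.eq_nil_iff_forall_not_mem]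
  intro u hu
  have hb := blk_of_mem_liveLevel hu
  have hl := length_of_mem_liveLevel hu
  have hf := answer_block_false_of_le hgn ρ (u := u) (by omega)
  rw [hb] at hf
  exact Bool.noConfusion hf

/-- **The candidates are unchanged for any over-estimate `W' ≥ W` of the width** (under consistency).
[folklore] -/
theorem descentCands_eq_of_le (hgn : ∀ v ∈ (nodeProblem F r c k).no, g v = false)
    (ρ : List (Fin (numOracleBits F x) × Bool)) (sgl : List Bool → Bool) (used : List (List Bool)) {W' : ℕ}
    (hW : oracleWidth F x ≤ W') :
    descentCands (fun u => g (encBlock F x ρ u)) sgl W' used =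
      descentCands (fun u => g (encBlock F x ρ u)) sgl (oracleWidth F x) used := by
  obtain ⟨m, rfl⟩ := Nat.exists_eq_add_of_le hW
  unfold descentCands
  congr 1
  rw [List.range_add, List.flatMap_append]
  suffices h : ((List.range m).map (oracleWidth F x + ·)).flatMap (liveLevel fun u => g (encBlock F x ρ u)) = [] by
    rw [h, List.append_nil]
  rw [List.flatMap_eq_nil_iff]
  intro j hj
  obtain ⟨i, -, rfl⟩ := List.mem_map.1 hj
  exact liveLevel_eq_nil_of_le hgn ρ (Nat.le_add_right _ _)

/-- **The pick is unchanged for any over-estimate `W' ≥ W` of the width** (under consistency). [folklore] -/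
theorem descentPick_eq_of_le (hgn : ∀ v ∈ (nodeProblem F r c k).no, g v = false)
    (ρ : List (Fin (numOracleBits F x) × Bool)) (sgl : List Bool → Bool) (used : List (List Bool)) {W' : ℕ}
    (hW : oracleWidth F x ≤ W') :
    descentPick (fun u => g (encBlock F x ρ u)) sgl W' used =
      descentPick (fun u => g (encBlock F x ρ u)) sgl (oracleWidth F x) used := by
  unfold descentPick
  rw [descentCands_eq_of_le hgn ρ sgl used hW]

end SimTreePB

end Summit.QuantumAdvantage.QuantumAdvantage.Cruxes.TransferPB.Birth

end
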